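import Literature.AnabelianGeometry.AbsoluteAnabelian.AbsTopIProp410Sub
import HarnessLib

/-!
# [AbsTopI] Prop 4.10 (iv): the kit `AbsTopI.Prop410.ReductionGraphKit` is inhabited over every
# `(X, K)` — a §4(iii) NON-VACUITY witness, DEGENERATE-honest (abc-iut-w5-d197, gen 2)

S. Mochizuki, *Topics in absolute anabelian geometry I: generalities* (2012) [AbsTopI], Prop 4.10 (iv)
p. 60: the vertices of the dual graph `Γ_H` of the special fibre of a stable model of the covering
corresponding to `H`, the action of `N(H)` on them, and a verticial subgroup `Π_v ⊆ H[l]` per vertex —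
typed by abc-iut-L4-t13 as the KIT `AbsTopI.Prop410.ReductionGraphKit X K` over a co-free completion
kit `K : CoFreeLKit X` (`AbsTopIProp410Sub.lean`).  The row read ZERO producers in the L4 inhabitation
census v2 (05:58Z).  This PROOF-ONLY file (no `def`/`instance`/`structure`) records that the kit is
inhabited over EVERY `(X, K)` by the ONE-VERTEX dual graph: `Γ_H := {•}` for every `H`, trivial
action, `Π_• := H[l]` (the whole group is verticial).

HONEST LABEL «degenerate»: this is the shape of `Γ_H` when the covering has GOOD reduction
(irreducible smooth special fibre, `Π_v = H[l]`); assigning it to every `H` is a consistency witness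
for the kit's axioms (`act_eq_self_of_mem` is the only law), not the stable-reduction data of a curve
(no stable model is constructed in the tree).  No side taken on [IUTchIII] Cor 3.12; typed ≠ proved.
-/

namespace Literature.AnabelianGeometry.AbsoluteAnabelian.AbsTopI.Prop410

open Literature.AnabelianGeometry.SemiGraphs

variable {p : ℕ} [Fact p.Prime]

/-- **[AbsTopI] Prop 4.10 (iv) p. 60 — the kit is inhabited (one-vertex dual graph).**  Over every
`X : TemperedCurve p` and every co-free completion kit `K`, `ReductionGraphKit X K` has the inhabitant
`Γ_H = {•}`, trivial `N(H)`-action, `Π_• = H[l]`.  Label «degenerate» (good-reduction shape for every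
`H`). [cite: MochizukiAbsTopI2012, Prop 4.10 (iv) p.60] -/
theorem ReductionGraphKit.nonempty (X : TemperedCurve p) (K : CoFreeLKit X) :
    Nonempty (ReductionGraphKit X K) :=
  ⟨{ V := fun _ => PUnit
     act := fun _ _ _ v => v
     act_eq_self_of_mem := fun _ _ _ _ => rfl
     vert := fun _ _ _ => ⊤ }⟩

/-- The one-vertex inhabitant, with its shape recorded: one vertex per `H`, identity action, and the
whole `H[l]` as verticial subgroup. [cite: MochizukiAbsTopI2012, Prop 4.10 (iv) p.60] -/
theorem ReductionGraphKit.exists_oneVertex (X : TemperedCurve p) (K : CoFreeLKit X) :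
    ∃ R : ReductionGraphKit X K,
      (∀ H, Nonempty (R.V H ≃ PUnit.{1})) ∧
      (∀ H j hj (v : R.V H), R.act H j hj v = v) ∧
      ∀ H l (v : R.V H), R.vert H l v = ⊤ :=
  ⟨{ V := fun _ => PUnit
     act := fun _ _ _ v => v
     act_eq_self_of_mem := fun _ _ _ _ => rfl
     vert := fun _ _ _ => ⊤ },
    fun _ => ⟨Equiv.refl _⟩, fun _ _ _ _ => rfl, fun _ _ _ => rfl⟩

/-- In particular the kit is inhabited over abc-iut-L4-t13's CONSTRUCTED co-free completion kit
`CoFreeLKit.ofConstruction X` whenever that kit is available (stated for an arbitrary kit to avoid the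
import; instantiate with `K := CoFreeLKit.ofConstruction X`). [cite: MochizukiAbsTopI2012, Prop 4.10 (iv) p.60] -/
theorem ReductionGraphKit.nonempty_forall (X : TemperedCurve p) :
    ∀ K : CoFreeLKit X, Nonempty (ReductionGraphKit X K) :=
  fun K => ReductionGraphKit.nonempty X K

end Literature.AnabelianGeometry.AbsoluteAnabelian.AbsTopI.Prop410
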